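import Summits.QuantumFields.BalabanUV.Beta.GAN24.MonotoneLoewner

/-!
# Beta / GAN24 / MonotoneLimit — a Loewner chain of PSD fibre matrices CONVERGES entrywise (no rate), and the one-datum band holds to the LIMIT;
# instance: the `j → ∞` limit of Bałaban's `QGQ*^{(Lc^j)}(p′)` exists by monotonicity alone
# (gan24-p4, BINDER-OWNERS row G-an2-4 ∕ (CONV-C), ALTERNATIVE DISCHARGE «rate OR monotonicity»; NOT IN PRINT — our proof attempt)

HONEST FRAMING (page 1 of everything the β sub-cell writes): discharging `BetaPertH` makes Bałaban's UV stability UNCONDITIONAL — a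
real constructive-QFT result; it is NOT the continuum limit and NOT the Clay problem.  HONEST DEPENDENCY (cell reorg 2026-08-19, verbatim):
«continuum YM on T⁴ ⇐ BetaPertH ∧ nine spine estimates (0/9 proved); BetaPertH ⇐ (D1) ∧ (D4) ∧ CAP+tail; G-an2-4 gates asym, D1 and NE2/3/4.»
HONEST LABEL: «not in print; our proof attempt; alternative discharge of the G-an2-4 row (rate OR monotonicity)»; 0 wall binders instantiated.

ABSOLUTE RULE (cell charter, verbatim): "No internally-minted statement may enter as a cited fact. Every hypothesis is either
kernel-proved in this package or a verbatim quotation of a PUBLISHED theorem with page reference. The manuscript(s) under audit are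
NOT citable for their own disputed steps — they are the thing under adjudication; programme-internal (2001/route/tribunal) claims
are never citable."  Nothing is cited; [folklore] (monotone bounded sequences converge; Cauchy–Schwarz for PSD entries).

## WHAT IS HERE (`HOME/b2b-balaban-gan24-p4/MONOTONE.md` V4 ∕ R7′: the LIMIT OBJECT of the monotone route is free).  For a chain of PSD steps
`P j − P (j+1) ⪰ 0` (`j ≥ k₀`) of PSD complex matrices: every diagonal real part is antitone and bounded below, hence convergent
(`tendsto_re_diag_shift`); every entry is Cauchy (`norm_apply_sq_le` on the PSD differences) hence convergent (`exists_tendsto_apply_of_steps`); and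
the one-datum pairwise band of `MonotoneLoewner.norm_sub_apply_le_of_steps` passes to the limit: `‖(P j − P∞) a b‖ ≤ η₀` for `j ≥ k₀`
(`norm_sub_lim_apply_le_of_steps`) — the CENTRED form consumed by `GAN24/Monotone.SupDev`, with the limit CONSTRUCTED, not assumed.  Instance (§2):
the transcribed (1.99) fibre matrices `QGQ*^{(Lc^j)}(p′)` converge entrywise as `j → ∞` for every `a > 0`, `p′ ≠ 0`, by asym1's monotonicity and the
printed bounds (1.100) alone — no rate (the tree's rates for these objects, t4-ne2 `phiMu_rate`, are not used).
-/

namespace Summit.QuantumFields.BalabanUV.Beta.GAN24.MonotoneLimit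

open scoped ComplexOrder
open Filter Topology Matrix
open Summit.QuantumFields.BalabanUV.Beta.GAN24.MonotoneLoewner (norm_apply_sq_le re_diag_nonneg posSemidef_sub_of_steps
  norm_sub_apply_le_of_steps)

/-! ## §1 Entrywise convergence of a PSD chain -/

section Chain

variable {n : Type*} {P : ℕ → Matrix n n ℂ} {k₀ : ℕ}

/-- along the chain the real diagonal is antitone after the shift `i ↦ P (k₀ + i)`. [folklore] -/
theorem antitone_re_diag_shift (hstep : ∀ j, k₀ ≤ j → (P j - P (j + 1)).PosSemidef) (a : n) :
    Antitone fun i : ℕ => ((P (k₀ + i)) a a).re := by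
  refine antitone_nat_of_succ_le fun i => ?_
  have h := re_diag_nonneg (hstep (k₀ + i) (Nat.le_add_right _ _)) a
  rw [Matrix.sub_apply, Complex.sub_re] at h
  show (P (k₀ + (i + 1)) a a).re ≤ (P (k₀ + i) a a).re
  rw [← Nat.add_assoc]
  linarith

/-- **THE REAL DIAGONAL CONVERGES** (antitone, bounded below by `0` when the `P j` are PSD). [folklore] -/
theorem tendsto_re_diag_shift (hstep : ∀ j, k₀ ≤ j → (P j - P (j + 1)).PosSemidef) (hpos : ∀ j, k₀ ≤ j → (P j).PosSemidef) (a : n) :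
    Tendsto (fun i : ℕ => ((P (k₀ + i)) a a).re) atTop (𝓝 (⨅ i : ℕ, ((P (k₀ + i)) a a).re)) :=
  tendsto_atTop_ciInf (antitone_re_diag_shift hstep a) ⟨0, by
    rintro _ ⟨i, rfl⟩
    exact re_diag_nonneg (hpos (k₀ + i) (Nat.le_add_right _ _)) a⟩

/-- an antitone real sequence converging to `L`: from some index on, `d N − d i < ε` for all `i ≥ N`. [folklore] -/
theorem eventually_sub_lt_of_antitone_tendsto {d : ℕ → ℝ} {L ε : ℝ} (hd : Antitone d) (hL : Tendsto d atTop (𝓝 L))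
    (hε : 0 < ε) : ∃ N, ∀ i, N ≤ i → 0 ≤ d N - d i ∧ d N - d i < ε := by
  have hge : ∀ i, L ≤ d i := fun i => hd.le_of_tendsto hL i
  obtain ⟨N, hN⟩ := (Filter.eventually_atTop.mp ((tendsto_order.1 hL).2 (L + ε) (by linarith)))
  exact ⟨N, fun i hi => ⟨sub_nonneg.mpr (hd hi), by linarith [hN N le_rfl, hge i]⟩⟩

/-- **EVERY ENTRY IS CAUCHY** along a PSD chain of PSD matrices (Cauchy–Schwarz `‖M a b‖² ≤ re M a a · re M b b` on the PSD differences). [folklore] -/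
theorem cauchySeq_apply_shift (hstep : ∀ j, k₀ ≤ j → (P j - P (j + 1)).PosSemidef) (hpos : ∀ j, k₀ ≤ j → (P j).PosSemidef)
    (a b : n) : CauchySeq fun i : ℕ => (P (k₀ + i)) a b := by
  refine Metric.cauchySeq_iff'.mpr fun ε hε => ?_
  obtain ⟨Na, hNa⟩ := eventually_sub_lt_of_antitone_tendsto (antitone_re_diag_shift hstep a) (tendsto_re_diag_shift hstep hpos a) hε
  obtain ⟨Nb, hNb⟩ := eventually_sub_lt_of_antitone_tendsto (antitone_re_diag_shift hstep b) (tendsto_re_diag_shift hstep hpos b) hε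
  refine ⟨max Na Nb, fun i hi => ?_⟩
  set N := max Na Nb with hN
  have hNi : k₀ + N ≤ k₀ + i := Nat.add_le_add_left hi k₀
  have hPSD := posSemidef_sub_of_steps hstep (k₀ + N) (k₀ + i) (Nat.le_add_right _ _) hNi
  have hsq := norm_apply_sq_le hPSD a b
  simp only [Matrix.sub_apply, Complex.sub_re] at hsq
  -- the diagonal deviations from `N` are `< ε` and `≥ 0`
  have ha : 0 ≤ (P (k₀ + N) a a).re - (P (k₀ + i) a a).re ∧ (P (k₀ + N) a a).re - (P (k₀ + i) a a).re < ε := by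
    have h1 := hNa i ((le_max_left _ _).trans hi)
    have h2 := hNa N (le_max_left _ _)
    have hmono := antitone_re_diag_shift hstep a hi
    constructor <;> [exact sub_nonneg.mpr hmono; linarith [h1.2, h2.1]]
  have hb : 0 ≤ (P (k₀ + N) b b).re - (P (k₀ + i) b b).re ∧ (P (k₀ + N) b b).re - (P (k₀ + i) b b).re < ε := by
    have h1 := hNb i ((le_max_right _ _).trans hi)
    have h2 := hNb N (le_max_right _ _)
    have hmono := antitone_re_diag_shift hstep b hi
    constructor <;> [exact sub_nonneg.mpr hmono; linarith [h1.2, h2.1]]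
  rw [dist_comm, dist_eq_norm]
  have hlt : ‖P (k₀ + N) a b - P (k₀ + i) a b‖ ^ 2 < ε ^ 2 := by
    calc ‖P (k₀ + N) a b - P (k₀ + i) a b‖ ^ 2 ≤ _ := hsq
      _ < ε * ε := mul_lt_mul'' ha.2 hb.2 ha.1 hb.1
      _ = ε ^ 2 := (sq ε).symm
  exact (pow_lt_pow_iff_left₀ (norm_nonneg _) hε.le two_ne_zero).mp hlt

/-- **THE CHAIN CONVERGES ENTRYWISE**: there is a limit matrix `P∞` with `P j a b → P∞ a b` for every entry. [folklore] -/
theorem exists_tendsto_apply_of_steps (hstep : ∀ j, k₀ ≤ j → (P j - P (j + 1)).PosSemidef) (hpos : ∀ j, k₀ ≤ j → (P j).PosSemidef) :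
    ∃ Pinf : Matrix n n ℂ, ∀ a b, Tendsto (fun j => P j a b) atTop (𝓝 (Pinf a b)) := by
  have h : ∀ a b, ∃ z : ℂ, Tendsto (fun i : ℕ => (P (k₀ + i)) a b) atTop (𝓝 z) := fun a b =>
    cauchySeq_tendsto_of_complete (cauchySeq_apply_shift hstep hpos a b)
  choose z hz using h
  refine ⟨fun a b => z a b, fun a b => ?_⟩
  have := hz a b
  rw [show (fun i : ℕ => P (k₀ + i) a b) = (fun j => P j a b) ∘ (fun i => i + k₀) from funext fun i => by simp [Nat.add_comm]] at this
  exact (Filter.tendsto_add_atTop_iff_nat k₀).mp this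

/-- **THE ONE-DATUM BAND TO THE LIMIT**: a PSD chain from `k₀`, the trace datum `re tr (P k₀ − P j) ≤ η₀` (`j ≥ k₀`) and ANY entrywise limit `P∞` give
`‖(P j − P∞) a b‖ ≤ η₀` for all `j ≥ k₀` — the centred form of (MONO-K) (`GAN24/Monotone.SupDev` with a constant majorant), limit included. [folklore] -/
theorem norm_sub_lim_apply_le_of_steps [Fintype n] (hstep : ∀ j, k₀ ≤ j → (P j - P (j + 1)).PosSemidef) {η₀ : ℝ}
    (hdat : ∀ j, k₀ ≤ j → (P k₀ - P j).trace.re ≤ η₀) {Pinf : Matrix n n ℂ}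
    (hlim : ∀ a b, Tendsto (fun j => P j a b) atTop (𝓝 (Pinf a b))) :
    ∀ j, k₀ ≤ j → ∀ a b, ‖(P j - Pinf) a b‖ ≤ η₀ := by
  intro j hj a b
  have hc : Tendsto (fun j' => ‖(P j - P j') a b‖) atTop (𝓝 ‖(P j - Pinf) a b‖) := by
    have h1 : Tendsto (fun j' => (P j - P j') a b) atTop (𝓝 ((P j - Pinf) a b)) := by
      simp only [Matrix.sub_apply]
      exact tendsto_const_nhds.sub (hlim a b)
    exact h1.norm
  exact le_of_tendsto hc (Filter.eventually_atTop.mpr ⟨k₀, fun j' hj' => norm_sub_apply_le_of_steps hstep hdat j j' hj hj' a b⟩)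

end Chain

/-! ## §2 Instance: the `j → ∞` limit of `QGQ*^{(Lc^j)}(p′)` exists, entrywise, by monotonicity alone -/

section QGQ

open Literature.MathematicalPhysics.QuantumFieldTheory.Balaban1983to89.B5QGQ199Rate (qgq)
open Summit.QuantumFields.BalabanUV.Beta.GAN24.MonotoneLoewner (posSemidef_qgq_pow_sub qgq_isHermitian qform_eq_star_dotProduct_mulVec
  posSemidef_of_isHermitian_re_nonneg re_diag_qgq_bounds re_trace_qgq_bounds)
open Literature.MathematicalPhysics.QuantumFieldTheory.Balaban1983to89.B5QGQ199Rate (ineq1100_lower)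
open Literature.MathematicalPhysics.QuantumFieldTheory.Balaban1983to89.B5Prop11Leaves (one_le_phiMu phiMu)
open scoped Real

variable {d : ℕ}

/-- `QGQ*^{(n)}(p′)` is PSD for `a > 0`, `p′ ≠ 0` (printed lower half of (1.100) with `φ_μ ≥ 1`). [folklore] -/
theorem posSemidef_qgq (n : ℕ) [NeZero n] (hn : 1 ≤ n) (a : ℝ) (ha : 0 < a) (s : Fin d → ℝ) (hs : ∀ κ, |s κ| ≤ π)
    (ν₀ : Fin d) (hν₀ : s ν₀ ≠ 0) : (qgq n a s).PosSemidef := by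
  refine posSemidef_of_isHermitian_re_nonneg (qgq_isHermitian n a s) fun w => ?_
  rw [← qform_eq_star_dotProduct_mulVec]
  refine le_trans (mul_nonneg (inv_nonneg.mpr ha.le) (Finset.sum_nonneg fun κ _ => mul_nonneg ?_ (sq_nonneg _)))
    (ineq1100_lower n hn a ha s hs ν₀ hν₀ w)
  have hφ := one_le_phiMu n a ha.le κ s
  have hφ0 : 0 < phiMu n a κ s := by linarith
  rw [sub_nonneg, div_le_one hφ0]
  exact hφ

/-- **THE LIMIT `QGQ*^{(∞)}(p′)` EXISTS**: for `a > 0`, `p′ ≠ 0`, every entry of `QGQ*^{(Lc^j)}(p′)` converges as `j → ∞` — no rate used. [folklore] -/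
theorem exists_qgq_limit (Lc : ℕ) [NeZero Lc] (a : ℝ) (ha : 0 < a) (s : Fin d → ℝ) (hs : ∀ κ, |s κ| ≤ π) (ν₀ : Fin d)
    (hν₀ : s ν₀ ≠ 0) :
    ∃ Pinf : Matrix (Fin d) (Fin d) ℂ, ∀ μ ν, Tendsto (fun j => qgq (Lc ^ j) a s μ ν) atTop (𝓝 (Pinf μ ν)) :=
  exists_tendsto_apply_of_steps (P := fun j => qgq (Lc ^ j) a s) (k₀ := 0)
    (fun j _ => posSemidef_qgq_pow_sub Lc a ha.le s hs ν₀ hν₀ j 1)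
    (fun j _ => posSemidef_qgq (Lc ^ j) (Nat.one_le_iff_ne_zero.mpr (NeZero.ne _)) a ha s hs ν₀ hν₀)

/-- **… AND THE CRUDE BAND TO IT**: `‖(QGQ*^{(Lc^j)} − QGQ*^{(∞)})(p′)_{μν}‖ ≤ d·a⁻¹` for all `j` (datum from (1.100); a certified trace datum at one scale
sharpens it). [folklore] -/
theorem qgq_sub_limit_le_crude (Lc : ℕ) [NeZero Lc] (a : ℝ) (ha : 0 < a) (s : Fin d → ℝ) (hs : ∀ κ, |s κ| ≤ π) (ν₀ : Fin d)
    (hν₀ : s ν₀ ≠ 0) {Pinf : Matrix (Fin d) (Fin d) ℂ} (hlim : ∀ μ ν, Tendsto (fun j => qgq (Lc ^ j) a s μ ν) atTop (𝓝 (Pinf μ ν))) :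
    ∀ j (μ ν : Fin d), ‖(qgq (Lc ^ j) a s - Pinf) μ ν‖ ≤ d * a⁻¹ := by
  intro j μ ν
  refine norm_sub_lim_apply_le_of_steps (P := fun j => qgq (Lc ^ j) a s) (k₀ := 0)
    (fun j _ => posSemidef_qgq_pow_sub Lc a ha.le s hs ν₀ hν₀ j 1) (fun i _ => ?_) hlim j (Nat.zero_le _) μ ν
  have h0 := re_trace_qgq_bounds (Lc ^ 0) (Nat.one_le_iff_ne_zero.mpr (NeZero.ne _)) a ha s hs ν₀ hν₀
  have hi := re_trace_qgq_bounds (Lc ^ i) (Nat.one_le_iff_ne_zero.mpr (NeZero.ne _)) a ha s hs ν₀ hν₀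
  rw [Matrix.trace_sub, Complex.sub_re]
  linarith [h0.2, hi.1]

end QGQ

end Summit.QuantumFields.BalabanUV.Beta.GAN24.MonotoneLimit
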